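import Literature.AnabelianGeometry.SemiGraphs.PSCIrreducibleNodalConj
import HarnessLib

/-!
# [CombGC] Prop. 1.2 (i) at irreducible data with SEVERAL self-nodes (one vertex, `k` loops)

Mochizuki, *A combinatorial version of the Grothendieck conjecture* [CombGC] §1, Prop. 1.2 (i) p. 8
[cite: MochizukiCombGC2007, Prop 1.2(i) p.8].  PROOF-ONLY sequel (abc-iut-f-164 gen 2; row F-0459
`PSCDatum.OpenInterDeterminesComponentHolds`) to `PSCIrreducibleNodalShape.lean` /
`PSCIrreducibleNodalConj.lean` (one self-node).  THE DATA OF IRREDUCIBLE `k`-NODAL SHAPE are what [CombGC]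
Def. 1.1 extracts from an IRREDUCIBLE pointed stable curve with `k ≤ g` nodes (geometric genus `g − k`,
`r` marked points; dual semi-graph = one vertex with `k` loops and `r` open edges — the deeper strata of
`Δ_irr`, down to the maximally degenerate irreducible curves `k = g`): `Π` is a pro-`Σ` completion
`ι : Γ_{g,r} → Π` of the smoothing, the node groups are `Π_{ν_m} = closure ι⟨b_m⟩` (`m < k`: the
vanishing cycles are the pairwise disjoint, jointly non-separating curves `b_0, …, b_{k−1}`), the cusp
groups `closure ι⟨c_j⟩` — hypotheses `hE` (through a bijection of the nodes with `Fin k`), `hC`; the single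
vertex group does not enter Prop. 1.2 (i).

## The argument (edge-like case)

* node `ν_m` vs node `ν_{m'}` / vs cusp: the handle character `b_m ↦ 1` (every other generator `↦ 0`)
  kills `b_{m'}` and every cusp and is `1` on `ι(b_m)` — abelian;
* cusp `c_j` vs node `ν_m`: the two-cusp character (`r ≥ 2`); for `r = 1` the CONJUGACY engine of
  `PSCIrreducibleNodalConj.lean` with the Heisenberg quotient `(a_m, b_m) ↦ (X, Y)`, `c_0 ↦ Z⁻¹` — the
  closure of `ι⟨b_m⟩` maps into `⟨Y⟩`, which contains no non-trivial power of the central `Z`;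
* cusp vs cusp: malnormality of cusp inertia (abc-iut-L3-t4).
Results: `edgeLikeOpenInterDeterminesEdge_of_irreducibleMultiNodal`, `openInterDeterminesComponent_of_irreducibleMultiNodal`
(verticial / unramified cases trivial at one vertex), for every hyperbolic `(g, r)` and `k ≤ g`.  Shape
instances are consistency evidence for the typed schema, not the printed theorem for all pointed stable
curves; nothing here takes a side on [IUTchIII] Cor. 3.12.
-/

noncomputable section

namespace Literature.AnabelianGeometry.SemiGraphs

open scoped Pointwise
open Literature.GroupTheory.CombinatorialGroupTheory
open SemiGraphOfAnabelioids (IsProSigmaCompletion)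
open Multiplicative

universe u

namespace PSCDatum

open TwoComponentAffine

variable {P : Type u} [Group P] [TopologicalSpace P] [IsTopologicalGroup P]
variable [CompactSpace P] [T2Space P] [TotallyDisconnectedSpace P] {Sigma : Set ℕ} {g r : ℕ}

omit [CompactSpace P] [T2Space P] [TotallyDisconnectedSpace P] in
/-- A conjugate of a closed subgroup is closed (private copy of abc-iut-w5-d183's `isClosed_conj_smul`).
[cite: MochizukiCombGC2007, Def 1.1(ii) p.6] -/
private theorem isClosed_conj_smul₆ {A : Subgroup P} (hA : IsClosed (A : Set P)) (γ : ConjAct P) :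
    IsClosed ((γ • A : Subgroup P) : Set P) := by
  have h : ((γ • A : Subgroup P) : Set P) = (fun x : P => γ⁻¹ • x) ⁻¹' (A : Set P) := by
    ext x
    rw [SetLike.mem_coe, Subgroup.mem_pointwise_smul_iff_inv_smul_mem]
    rfl
  rw [h]
  refine hA.preimage ?_
  simp only [ConjAct.smul_def]
  fun_prop

omit [T2Space P] in
/-- **Node versus anything by the handle character `b_m ↦ 1`.**  For a node group
`S = γ₁ · closure ι⟨b_{i₁}⟩ · γ₁⁻¹` and a target `T = γ₂ · closure ι⟨z⟩ · γ₂⁻¹` with `z` a generator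
(`b_{i₂}`, `i₂ ≠ i₁`, or a cusp generator `c_j`) killed by the handle character `b_{i₁} ↦ 1`, the
intersection `S ∩ T` is not open in `S`. [cite: MochizukiCombGC2007, Prop 1.2(i) p.8] -/
private theorem node_not_isOpen_of_handleCharacter {ι : PuncturedSurfaceGroup g r →* P}
    (hι : IsProSigmaCompletion Sigma ι) {ℓ : ℕ} (hℓ : ℓ.Prime) (hℓS : ℓ ∈ Sigma) (γ₁ γ₂ : ConjAct P)
    (i₁ : Fin g) (z : PuncturedSurfaceGroup g r)
    (hz : ∀ (n : ℕ) (φ : PuncturedSurfaceGroup g r →* Multiplicative (ZMod (ℓ ^ n))),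
      (∀ i, φ (PuncturedSurfaceGroup.b i) = ofAdd (if i = i₁ then 1 else 0)) →
      (∀ i, φ (PuncturedSurfaceGroup.a i) = 1) → (∀ j, φ (PuncturedSurfaceGroup.c j) = 1) → φ z = 1) :
    ¬ IsOpen ((((γ₁ • ((Subgroup.zpowers (PuncturedSurfaceGroup.b (r := r) i₁)).map
        ι).topologicalClosure) ⊓ γ₂ • ((Subgroup.zpowers z).map ι).topologicalClosure).subgroupOf
      (γ₁ • ((Subgroup.zpowers (PuncturedSurfaceGroup.b (r := r) i₁)).map ι).topologicalClosure) :
        Subgroup (γ₁ • ((Subgroup.zpowers (PuncturedSurfaceGroup.b (r := r) i₁)).map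
          ι).topologicalClosure : Subgroup P)) :
      Set (γ₁ • ((Subgroup.zpowers (PuncturedSurfaceGroup.b (r := r) i₁)).map
        ι).topologicalClosure : Subgroup P)) := by
  classical
  refine not_isOpen_inf_subgroupOf_of_characters hℓ.one_lt _ _
    (x := γ₁ • ι (PuncturedSurfaceGroup.b (r := r) i₁))
    (Subgroup.smul_mem_pointwise_smul _ _ _ (Subgroup.le_topologicalClosure _
      (Subgroup.mem_map_of_mem ι (Subgroup.mem_zpowers _)))) fun n => ?_
  let wb : Fin g → ZMod (ℓ ^ n) := fun i => if i = i₁ then 1 else 0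
  obtain ⟨φ, hφa, hφb, hφc⟩ :=
    PuncturedSurfaceGroup.exists_handleCuspCharacter (r := r) 0 wb 0 (by simp)
  obtain ⟨χ, hχc, hχ⟩ := exists_continuous_extend_zmod_pow hι hℓ hℓS n φ
  refine ⟨χ, smul_le_ker_of_le_ker (topologicalClosure_map_zpowers_le_ker ι χ hχc _ ?_) γ₂,
    by rw [map_conjAct_smul_eq_self, hχ, hφb]; simp [wb]⟩
  rw [hχ]
  exact hz n φ hφb (fun i => by rw [hφa]; rfl) (fun j => by rw [hφc]; rfl)

/-! ### The edge-like case at irreducible `k`-nodal shape -/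

/-- **[CombGC] Prop. 1.2 (i), edge-like case, at irreducible `k`-nodal shape** (`k ≤ g` self-nodes
`closure ι⟨b_m⟩`, cusp groups `closure ι⟨c_j⟩`, `(g, r)` hyperbolic): node/node and node/cusp by the handle
characters `b_m ↦ 1`; cusp/node by the two-cusp character or (one marked point) the conjugacy engine on the
handle `m`; cusp/cusp by malnormality. [cite: MochizukiCombGC2007, Prop 1.2(i) p.8] -/
theorem edgeLikeOpenInterDeterminesEdge_of_irreducibleMultiNodal (hne : Sigma.Nonempty)
    (hprime : ∀ p ∈ Sigma, p.Prime) (ι : PuncturedSurfaceGroup g r →* P)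
    (hι : IsProSigmaCompletion Sigma ι) (G : PSCDatum P) {k : ℕ} (hk : k ≤ g)
    (hhyp : PuncturedSurfaceGroup.IsHyperbolicType g r) (e : G.graph.C ≃ Fin r)
    (hC : ∀ c, G.cuspGp c =
      ((PuncturedSurfaceGroup.cuspInertia (g := g) (e c)).map ι).topologicalClosure)
    (eN : G.graph.N ≃ Fin k)
    (hE : ∀ m, G.nodeGp m = ((Subgroup.zpowers
      (PuncturedSurfaceGroup.b (r := r) (Fin.castLE hk (eN m)))).map ι).topologicalClosure) :
    G.EdgeLikeOpenInterDeterminesEdge := by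
  classical
  have hne' := hne
  obtain ⟨ℓ, hℓS⟩ := hne
  have hℓ : ℓ.Prime := hprime ℓ hℓS
  intro e₁ e₂ γ₁ γ₂ hopen
  by_contra hne12
  rcases e₁ with m₁ | c₁ <;> rcases e₂ with m₂ | c₂
  · -- node vs node
    by_cases hm : m₁ = m₂
    · exact hne12 (by rw [hm])
    have hi : Fin.castLE hk (eN m₂) ≠ Fin.castLE hk (eN m₁) := fun h =>
      hm (eN.injective (Fin.castLE_injective hk h)).symm
    have hopen' := hopen
    change IsOpen ((((γ₁ • G.nodeGp m₁) ⊓ γ₂ • G.nodeGp m₂).subgroupOf (γ₁ • G.nodeGp m₁) :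
      Subgroup (γ₁ • G.nodeGp m₁ : Subgroup P)) : Set (γ₁ • G.nodeGp m₁ : Subgroup P)) at hopen'
    rw [hE m₁, hE m₂] at hopen'
    exact node_not_isOpen_of_handleCharacter hι hℓ hℓS γ₁ γ₂ _ _
      (fun n φ hb _ _ => by rw [hb, if_neg hi]; rfl) hopen'
  · -- node vs cusp
    have hopen' := hopen
    change IsOpen ((((γ₁ • G.nodeGp m₁) ⊓ γ₂ • G.cuspGp c₂).subgroupOf (γ₁ • G.nodeGp m₁) :
      Subgroup (γ₁ • G.nodeGp m₁ : Subgroup P)) : Set (γ₁ • G.nodeGp m₁ : Subgroup P)) at hopen'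
    rw [hE m₁, hC, PuncturedSurfaceGroup.cuspInertia] at hopen'
    exact node_not_isOpen_of_handleCharacter hι hℓ hℓS γ₁ γ₂ _ _ (fun n φ _ _ hc => hc _) hopen'
  · -- cusp `j = e c₁` vs node `m₂`
    by_cases hk' : ∃ k' : Fin r, k' ≠ e c₁
    · -- abelian: `δ_j − δ_k'` (every `b_i ↦ 0`)
      obtain ⟨k', hkj⟩ := hk'
      have hopen' := hopen
      change IsOpen ((((γ₁ • G.cuspGp c₁) ⊓ γ₂ • G.nodeGp m₂).subgroupOf (γ₁ • G.cuspGp c₁) :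
        Subgroup (γ₁ • G.cuspGp c₁ : Subgroup P)) : Set (γ₁ • G.cuspGp c₁ : Subgroup P)) at hopen'
      rw [hE m₂, hC, PuncturedSurfaceGroup.cuspInertia] at hopen'
      refine not_isOpen_inf_subgroupOf_of_characters hℓ.one_lt _ _
        (x := γ₁ • ι (PuncturedSurfaceGroup.c (e c₁)))
        (Subgroup.smul_mem_pointwise_smul _ _ _ (Subgroup.le_topologicalClosure _
          (Subgroup.mem_map_of_mem ι (Subgroup.mem_zpowers _)))) (fun n => ?_) hopen'
      let wc : Fin r → ZMod (ℓ ^ n) := fun l =>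
        (if l = e c₁ then 1 else 0) + (if l = k' then -1 else 0)
      obtain ⟨φ, -, hφb, hφc⟩ :=
        PuncturedSurfaceGroup.exists_handleCuspCharacter (g := g) 0 0 wc (sum_twoDelta (e c₁) k')
      obtain ⟨χ, hχc, hχ⟩ := exists_continuous_extend_zmod_pow hι hℓ hℓS n φ
      refine ⟨χ, smul_le_ker_of_le_ker (topologicalClosure_map_zpowers_le_ker ι χ hχc _ ?_) γ₂,
        by rw [map_conjAct_smul_eq_self, hχ, hφc]; simp [wc, hkj.symm]⟩
      rw [hχ, hφb]; rfl
    · -- one marked point: the conjugacy engine with the Heisenberg quotient on the handle of the node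
      have hopen' := hopen
      change IsOpen ((((γ₁ • G.cuspGp c₁) ⊓ γ₂ • G.nodeGp m₂).subgroupOf (γ₁ • G.cuspGp c₁) :
        Subgroup (γ₁ • G.cuspGp c₁ : Subgroup P)) : Set (γ₁ • G.cuspGp c₁ : Subgroup P)) at hopen'
      rw [hE m₂] at hopen'
      refine not_isOpen_inf_subgroupOf_of_heisenberg_conj hι hℓ hℓS γ₁ γ₂
        (PuncturedSurfaceGroup.c (e c₁)) (PuncturedSurfaceGroup.b (r := r) (Fin.castLE hk (eN m₂))) ?_
        (fun n φ X Y Z hXY _ => ?_) hopen'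
      · rw [hC]
        exact Subgroup.smul_mem_pointwise_smul _ _ _ (Subgroup.le_topologicalClosure _
          (Subgroup.mem_map_of_mem ι (Subgroup.mem_zpowers _)))
      · have hrel : X * Y * X⁻¹ * Y⁻¹ * Z⁻¹ = 1 := by rw [hXY, mul_inv_cancel]
        obtain ⟨ψ, -, hb, hc, -, -⟩ := PuncturedSurfaceGroup.exists_hom_handle_cusp
          (g := g) (r := r) (Fin.castLE hk (eN m₂)) (e c₁) X Y Z⁻¹ hrel
        exact ⟨ψ, Or.inr hc, hb⟩
  · -- cusp vs cusp: malnormality of cusp inertia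
    by_cases hc : c₁ = c₂
    · exact hne12 (by rw [hc])
    have hopen' := hopen
    change IsOpen ((((γ₁ • G.cuspGp c₁) ⊓ (γ₂ • G.cuspGp c₂)).subgroupOf (γ₁ • G.cuspGp c₁) :
      Subgroup (γ₁ • G.cuspGp c₁ : Subgroup P)) : Set (γ₁ • G.cuspGp c₁ : Subgroup P)) at hopen'
    rw [G.smul_cuspGp_inf_smul_cuspGp_eq_bot hne' hprime hhyp ι hι e hC hc, Subgroup.bot_subgroupOf,
      Subgroup.coe_bot] at hopen'
    haveI : DiscreteTopology (γ₁ • G.cuspGp c₁ : Subgroup P) :=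
      discreteTopology_iff_isOpen_singleton_one.mpr hopen'
    haveI : CompactSpace (γ₁ • G.cuspGp c₁ : Subgroup P) :=
      isCompact_iff_compactSpace.mp (isClosed_conj_smul₆ (G.isClosed_cuspGp c₁) γ₁).isCompact
    haveI := G.infinite_cuspGp hne' hprime hhyp ι hι e hC c₁
    haveI : Infinite (γ₁ • G.cuspGp c₁ : Subgroup P) :=
      Infinite.of_injective _ (Subgroup.equivSMul γ₁ (G.cuspGp c₁)).injective
    exact (‹Infinite (γ₁ • G.cuspGp c₁ : Subgroup P)›).not_finite finite_of_compact_of_discrete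

/-- **[CombGC] Prop. 1.2 (i) — all three cases — at every datum of irreducible `k`-nodal shape** (one
vertex: the verticial and unramified cases are trivial). [cite: MochizukiCombGC2007, Prop 1.2(i) p.8] -/
theorem openInterDeterminesComponent_of_irreducibleMultiNodal (hne : Sigma.Nonempty)
    (hprime : ∀ p ∈ Sigma, p.Prime) (ι : PuncturedSurfaceGroup g r →* P)
    (hι : IsProSigmaCompletion Sigma ι) (G : PSCDatum P) {k : ℕ} (hk : k ≤ g)
    (hhyp : PuncturedSurfaceGroup.IsHyperbolicType g r) (e : G.graph.C ≃ Fin r)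
    (hC : ∀ c, G.cuspGp c =
      ((PuncturedSurfaceGroup.cuspInertia (g := g) (e c)).map ι).topologicalClosure)
    (v₀ : G.graph.V) (hV : ∀ w, w = v₀) (eN : G.graph.N ≃ Fin k)
    (hE : ∀ m, G.nodeGp m = ((Subgroup.zpowers
      (PuncturedSurfaceGroup.b (r := r) (Fin.castLE hk (eN m)))).map ι).topologicalClosure) :
    G.VerticialOpenInterDeterminesVertex ∧ G.EdgeLikeOpenInterDeterminesEdge ∧
      G.UnrVerticialOpenInterDeterminesVertex :=
  ⟨G.verticialOpenInterDeterminesVertex_of_subsingleton v₀ hV,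
    G.edgeLikeOpenInterDeterminesEdge_of_irreducibleMultiNodal hne hprime ι hι hk hhyp e hC eN hE,
    G.unrVerticialOpenInterDeterminesVertex_of_subsingleton v₀ hV⟩

end PSCDatum

end Literature.AnabelianGeometry.SemiGraphs

end
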